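import Summits.QuantumFields.YangMills.Theorems.FluctuationComparisonRegPrIntLS2BetaResidualGauge
import HarnessLib

/-!
# (RG-K) Residual orbits: GAP♯ ⇒ ORB and EXW ∧ GAP♯ ⇒ GAP

Second (definition-free) file of the RG-K letters for LINE g18-1 `Cruxes/FluctuationComparisonRegPrIntL/Lines/semiclassical_s2beta.lean`
v6 (crux `stmt-QuantumFields-20520`; LINE OWNER WORDS 6–8).  It turns the two consequence sentences of v6's GAP♯ docstring into
kernel facts:

* §1 the ORBIT DISTANCE `w ↦ Σ_ℓ dist1(U ℓ · (w•U₀)(ℓ)⁻¹)²` on the (compact) residual set is continuous, hence ATTAINED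
  (`exists_orbitDistSq_eq_iInf`); so `⨅ ≤ 0` forces `U = w•U₀` for a residual `w` (★★ `exists_eq_gaugeAct_of_iInf_le_zero`: the
  attained sum of squares vanishes termwise and `dist1 g = 0 ⇒ g = 1`), and conversely the distance vanishes on the orbit.
* §2 ★★ GAP♯ ⇒ ORB (`argmin_eq_orbit_of_gapOrbit`): with the GAP♯ text as hypothesis, over every window datum the set of
  action-minimising small-field histories is the residual orbit of any of its points; ★ EXW ∧ GAP♯ ⇒ GAP
  (`uniformFibreGap_of_exactness_of_gapOrbit`): GAP stays servable to its v5 consumers.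

DOCKING (Cruxes workfiles cannot be imported): the hypotheses of §2 are the v6 texts of `WindowExactness` (VERBATIM),
`UniformFibreGapOrbit` and the conclusion `UniformFibreGap` with exactly two substitutions — `ResidualGauge F hJK` ↦ its v6 body
`{w | ∀ U, descendTo F ℰp J K hJK (GaugeField.gaugeAct w U) = descendTo F ℰp J K hJK U}` (carrier spelled `Site (F.P K) 0 → SU(2)`,
definitionally `GaugeTransf (F.P K) 0 SU(2)`) and `argminHist F γ b₀ p₀ ε₀ hJK V` ↦ its v6 body
`{U' | U' ∈ fibre … ∧ U' ∈ histGood … ∧ wilsonAction4 U' = minActionRegPr …}` — so in `Lines/semiclassical_s2beta.lean` both dock by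
`exact` (definitional unfolding of the two Cruxes defs; no token of any other decl changes).

HONEST: compactness bookkeeping over landed letters; this file proves NO stub of the line — EXW, GAP♯, LAPLACE (CHART∞ ∕ LIMIT ∕ KNIT ∕
DECAY), H4ᶜ, LFR♯ᶜ, S2β and crux 20520 stay OPEN; rung R3 (YM₃ on T³) is NOT d = 4, NOT infinite volume, NOT a mass gap, NOT Clay; the
Yang–Mills mass gap is NOT proved.
-/

noncomputable section

open MeasureTheory Filter Topology Set
open scoped Matrix.Norms.L2Operator
open Literature.MathematicalPhysics.QuantumFieldTheory.Balaban1983to89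
open Literature.MathematicalPhysics.QuantumFieldTheory.Balaban1983to89.T3ContinuumYM3Torus
open Literature.MathematicalPhysics.QuantumFieldTheory.Balaban1983to89.T3UnitLawDensityEML
open Literature.MathematicalPhysics.QuantumFieldTheory.Balaban1983to89.T3UnitScaleTilt
open Literature.MathematicalPhysics.QuantumFieldTheory.Balaban1983to89.T3TiltDescent
open Literature.MathematicalPhysics.QuantumFieldTheory.Balaban1983to89.T3PrintedRegularMinimiser
open Literature.MathematicalPhysics.QuantumFieldTheory.Balaban1983to89.T3ConstrainedMinimiser (fibre)
open Literature.MathematicalPhysics.QuantumFieldTheory.Balaban1983to89.T3PrintedRegularOrbits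
open Literature.MathematicalPhysics.QuantumFieldTheory.Balaban1983to89.Missing
open Literature.MathematicalPhysics.QuantumFieldTheory.Balaban1983to89.T4Continuum
open scoped Literature.MathematicalPhysics.QuantumFieldTheory.Balaban1983to89.T3OrbitAverage
open Summit.QuantumFields.YangMills.Theorems.FluctuationComparisonRegPrIntLS2BetaResidualGauge

namespace Summit.QuantumFields.YangMills.Theorems.FluctuationComparisonRegPrIntLS2BetaResidualGaugeOrbit

/-! ## §1 The orbit distance on the residual set: continuous, attained, vanishing exactly on the orbit -/

section Orbit

variable (F : T3Family) {J K : ℕ} (hJK : J ≤ K)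

/-- `dist1 g = 0` forces `g = 1` on `SU(2)` (`dist1 g = ‖g − 1‖`; local copy). [folklore] -/
theorem eq_one_of_dist1_eq_zero (g : Matrix.specialUnitaryGroup (Fin 2) ℂ) (h : dist1 g = 0) : g = 1 := by
  have h' : UnitaryModel.opDist1 (Literature.MathematicalPhysics.QuantumLattice.fundamentalRep (Fin 2) g) = 0 := h
  unfold UnitaryModel.opDist1 at h'
  rw [norm_eq_zero, sub_eq_zero, Literature.MathematicalPhysics.QuantumLattice.fundamentalRep_apply] at h'
  exact Subtype.ext h'

/-- The orbit-distance functional `w ↦ Σ_ℓ dist1(U ℓ · (w•U₀)(ℓ)⁻¹)²` is continuous on the residual set. [cite: Balaban1985Variational, (10) p.279] -/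
theorem continuous_orbitDistSq (U U₀ : GaugeField (F.P K) 0 (Matrix.specialUnitaryGroup (Fin 2) ℂ)) :
    Continuous fun w : {w : Site (F.P K) 0 → Matrix.specialUnitaryGroup (Fin 2) ℂ |
        ∀ U : GaugeField (F.P K) 0 (Matrix.specialUnitaryGroup (Fin 2) ℂ),
          descendTo F ℰp J K hJK (GaugeField.gaugeAct w U) = descendTo F ℰp J K hJK U} =>
      ∑ ℓ : PBond (F.P K) 0,
        dist1 (U ℓ * ((GaugeField.gaugeAct (w : Site (F.P K) 0 → Matrix.specialUnitaryGroup (Fin 2) ℂ) U₀) ℓ)⁻¹) ^ 2 := by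
  refine continuous_finsetSum _ fun ℓ _ => ?_
  have hdist : Continuous (dist1 : Matrix.specialUnitaryGroup (Fin 2) ℂ → ℝ) :=
    UnitaryModel.continuous_opDist1.comp (Literature.MathematicalPhysics.QuantumLattice.continuous_fundamentalRep (Fin 2))
  refine (hdist.comp ?_).pow 2
  have hval : Continuous fun w : {w : Site (F.P K) 0 → Matrix.specialUnitaryGroup (Fin 2) ℂ |
      ∀ U : GaugeField (F.P K) 0 (Matrix.specialUnitaryGroup (Fin 2) ℂ),
        descendTo F ℰp J K hJK (GaugeField.gaugeAct w U) = descendTo F ℰp J K hJK U} =>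
      (w : Site (F.P K) 0 → Matrix.specialUnitaryGroup (Fin 2) ℂ) :=
    continuous_subtype_val
  exact continuous_const.mul
    ((((continuous_apply ℓ.src).comp hval).mul continuous_const).mul ((continuous_apply ℓ.tgt).comp hval).inv).inv

/-- **THE ORBIT DISTANCE IS ATTAINED** on the compact residual set. [cite: Balaban1985Variational, (10) p.279] -/
theorem exists_orbitDistSq_eq_iInf (U U₀ : GaugeField (F.P K) 0 (Matrix.specialUnitaryGroup (Fin 2) ℂ)) :
    ∃ w₀ : {w : Site (F.P K) 0 → Matrix.specialUnitaryGroup (Fin 2) ℂ |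
        ∀ U : GaugeField (F.P K) 0 (Matrix.specialUnitaryGroup (Fin 2) ℂ),
          descendTo F ℰp J K hJK (GaugeField.gaugeAct w U) = descendTo F ℰp J K hJK U},
      (∑ ℓ : PBond (F.P K) 0,
          dist1 (U ℓ * ((GaugeField.gaugeAct (w₀ : Site (F.P K) 0 → Matrix.specialUnitaryGroup (Fin 2) ℂ) U₀) ℓ)⁻¹) ^ 2) =
        ⨅ w : {w : Site (F.P K) 0 → Matrix.specialUnitaryGroup (Fin 2) ℂ |
            ∀ U : GaugeField (F.P K) 0 (Matrix.specialUnitaryGroup (Fin 2) ℂ),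
              descendTo F ℰp J K hJK (GaugeField.gaugeAct w U) = descendTo F ℰp J K hJK U},
          ∑ ℓ : PBond (F.P K) 0,
            dist1 (U ℓ * ((GaugeField.gaugeAct (w : Site (F.P K) 0 → Matrix.specialUnitaryGroup (Fin 2) ℂ) U₀) ℓ)⁻¹) ^ 2 := by
  haveI := compactSpace_residualGauge F hJK
  haveI : Nonempty {w : Site (F.P K) 0 → Matrix.specialUnitaryGroup (Fin 2) ℂ |
      ∀ U : GaugeField (F.P K) 0 (Matrix.specialUnitaryGroup (Fin 2) ℂ),
        descendTo F ℰp J K hJK (GaugeField.gaugeAct w U) = descendTo F ℰp J K hJK U} := ⟨⟨1, residual_one F hJK⟩⟩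
  obtain ⟨w₀, -, hmin⟩ :=
    isCompact_univ.exists_isMinOn Set.univ_nonempty (continuous_orbitDistSq F hJK U U₀).continuousOn
  have hbdd : BddBelow (Set.range fun w : {w : Site (F.P K) 0 → Matrix.specialUnitaryGroup (Fin 2) ℂ |
      ∀ U : GaugeField (F.P K) 0 (Matrix.specialUnitaryGroup (Fin 2) ℂ),
        descendTo F ℰp J K hJK (GaugeField.gaugeAct w U) = descendTo F ℰp J K hJK U} =>
      ∑ ℓ : PBond (F.P K) 0,
        dist1 (U ℓ * ((GaugeField.gaugeAct (w : Site (F.P K) 0 → Matrix.specialUnitaryGroup (Fin 2) ℂ) U₀) ℓ)⁻¹) ^ 2) :=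
    ⟨0, by rintro _ ⟨w, rfl⟩; exact Finset.sum_nonneg fun ℓ _ => sq_nonneg _⟩
  exact ⟨w₀, le_antisymm (le_ciInf fun w => hmin (Set.mem_univ w)) (ciInf_le hbdd w₀)⟩

/-- ★★ **VANISHING ORBIT DISTANCE ⇒ SAME RESIDUAL ORBIT**: if `⨅_w Σ_ℓ dist1(U ℓ · (w•U₀)(ℓ)⁻¹)² ≤ 0` over the residual set then
`U = w•U₀` for a residual `w` (the infimum is attained, the attained sum of squares vanishes termwise, `dist1 = 0 ⇒ = 1`).
[cite: Balaban1985Variational, Thm 1 (8)-(10) p.279] -/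
theorem exists_eq_gaugeAct_of_iInf_le_zero (U U₀ : GaugeField (F.P K) 0 (Matrix.specialUnitaryGroup (Fin 2) ℂ))
    (h : (⨅ w : {w : Site (F.P K) 0 → Matrix.specialUnitaryGroup (Fin 2) ℂ |
            ∀ U : GaugeField (F.P K) 0 (Matrix.specialUnitaryGroup (Fin 2) ℂ),
              descendTo F ℰp J K hJK (GaugeField.gaugeAct w U) = descendTo F ℰp J K hJK U},
          ∑ ℓ : PBond (F.P K) 0,
            dist1 (U ℓ * ((GaugeField.gaugeAct (w : Site (F.P K) 0 → Matrix.specialUnitaryGroup (Fin 2) ℂ) U₀) ℓ)⁻¹) ^ 2) ≤ 0) :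
    ∃ w : Site (F.P K) 0 → Matrix.specialUnitaryGroup (Fin 2) ℂ,
      (∀ U' : GaugeField (F.P K) 0 (Matrix.specialUnitaryGroup (Fin 2) ℂ),
          descendTo F ℰp J K hJK (GaugeField.gaugeAct w U') = descendTo F ℰp J K hJK U') ∧
        U = GaugeField.gaugeAct w U₀ := by
  obtain ⟨w₀, hw₀⟩ := exists_orbitDistSq_eq_iInf F hJK U U₀
  rw [← hw₀] at h
  have hsum : (∑ ℓ : PBond (F.P K) 0, dist1 (U ℓ *
      ((GaugeField.gaugeAct (w₀ : Site (F.P K) 0 → Matrix.specialUnitaryGroup (Fin 2) ℂ) U₀) ℓ)⁻¹) ^ 2) = 0 :=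
    le_antisymm h (Finset.sum_nonneg fun ℓ _ => sq_nonneg _)
  rw [Finset.sum_eq_zero_iff_of_nonneg fun ℓ _ => sq_nonneg _] at hsum
  refine ⟨(w₀ : Site (F.P K) 0 → Matrix.specialUnitaryGroup (Fin 2) ℂ), w₀.2, funext fun ℓ => ?_⟩
  have hℓ := eq_one_of_dist1_eq_zero _ ((pow_eq_zero_iff two_ne_zero).mp (hsum ℓ (Finset.mem_univ ℓ)))
  exact mul_inv_eq_one.mp hℓ

/-- Conversely, on the residual orbit the orbit distance vanishes. [cite: Balaban1985Variational, Thm 1 (8)-(10) p.279] -/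
theorem iInf_orbitDistSq_eq_zero_of_residual {w : Site (F.P K) 0 → Matrix.specialUnitaryGroup (Fin 2) ℂ}
    (hw : ∀ U : GaugeField (F.P K) 0 (Matrix.specialUnitaryGroup (Fin 2) ℂ),
      descendTo F ℰp J K hJK (GaugeField.gaugeAct w U) = descendTo F ℰp J K hJK U)
    (U₀ : GaugeField (F.P K) 0 (Matrix.specialUnitaryGroup (Fin 2) ℂ)) :
    (⨅ w' : {w : Site (F.P K) 0 → Matrix.specialUnitaryGroup (Fin 2) ℂ |
          ∀ U : GaugeField (F.P K) 0 (Matrix.specialUnitaryGroup (Fin 2) ℂ),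
            descendTo F ℰp J K hJK (GaugeField.gaugeAct w U) = descendTo F ℰp J K hJK U},
        ∑ ℓ : PBond (F.P K) 0,
          dist1 ((GaugeField.gaugeAct w U₀) ℓ *
            ((GaugeField.gaugeAct (w' : Site (F.P K) 0 → Matrix.specialUnitaryGroup (Fin 2) ℂ) U₀) ℓ)⁻¹) ^ 2) = 0 := by
  haveI : Nonempty {w : Site (F.P K) 0 → Matrix.specialUnitaryGroup (Fin 2) ℂ |
      ∀ U : GaugeField (F.P K) 0 (Matrix.specialUnitaryGroup (Fin 2) ℂ),
        descendTo F ℰp J K hJK (GaugeField.gaugeAct w U) = descendTo F ℰp J K hJK U} := ⟨⟨1, residual_one F hJK⟩⟩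
  refine le_antisymm ?_ (le_ciInf fun w' => Finset.sum_nonneg fun ℓ _ => sq_nonneg _)
  have hbdd : BddBelow (Set.range fun w' : {w : Site (F.P K) 0 → Matrix.specialUnitaryGroup (Fin 2) ℂ |
      ∀ U : GaugeField (F.P K) 0 (Matrix.specialUnitaryGroup (Fin 2) ℂ),
        descendTo F ℰp J K hJK (GaugeField.gaugeAct w U) = descendTo F ℰp J K hJK U} =>
      ∑ ℓ : PBond (F.P K) 0,
        dist1 ((GaugeField.gaugeAct w U₀) ℓ *
          ((GaugeField.gaugeAct (w' : Site (F.P K) 0 → Matrix.specialUnitaryGroup (Fin 2) ℂ) U₀) ℓ)⁻¹) ^ 2) :=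
    ⟨0, by rintro _ ⟨w', rfl⟩; exact Finset.sum_nonneg fun ℓ _ => sq_nonneg _⟩
  have h1 := ciInf_le hbdd ⟨w, hw⟩
  refine h1.trans (le_of_eq (Finset.sum_eq_zero fun ℓ _ => ?_))
  rw [mul_inv_cancel, GaugeGroup.dist1_one, zero_pow two_ne_zero]

end Orbit

/-! ## §2 The two consequence sentences of v6's GAP♯ docstring as kernel facts -/

section Wrappers

/-- ★★ **GAP♯ ⇒ ORB — «`argminHist V` IS ONE RESIDUAL ORBIT»**.  Hypothesis = the v6 text of `UniformFibreGapOrbit` with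
`ResidualGauge F hJK` and `argminHist F γ b₀ p₀ ε₀ hJK V` replaced by their v6 bodies; conclusion: with the same thresholds, over every
window datum the set of action-minimising small-field histories is `{w•U₀ | w residual}` for any of its points `U₀`.
[cite: Balaban1985Variational, Thm 1 (8)-(10) p.279] -/
theorem argmin_eq_orbit_of_gapOrbit
    (hGap : ∀ (L : ℕ), ∃ pS : ℝ, ∀ (b₀ p₀ : ℝ), 0 < b₀ → pS ≤ p₀ → 0 < p₀ → ∃ ε₁ : ℝ, 0 < ε₁ ∧ ∀ (ε₀ : ℝ), 0 < ε₀ → ε₀ ≤ ε₁ →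
      ∃ γ₁ : ℝ, 0 < γ₁ ∧ ∃ μ : ℝ, 0 < μ ∧ ∀ (F : T3Family) (γ : ℝ), F.L = L → 0 < γ → γ ≤ γ₁ →
        ∀ (J K : ℕ) (hJK : J ≤ K) (V : GaugeField (F.P J) 0 (Matrix.specialUnitaryGroup (Fin 2) ℂ)), PlaqSmall (θBal F.L γ b₀ p₀ J) V →
          ∀ U₀ ∈ {U' | U' ∈ fibre F ℰp J K hJK V ∧ U' ∈ histGood F ℰp (θBal F.L γ b₀ p₀) K J ∧
              wilsonAction4 U' = minActionRegPr F J K hJK ε₀ V},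
            ∀ U ∈ fibre F ℰp J K hJK V, U ∈ histGood F ℰp (θBal F.L γ b₀ p₀) K J →
              μ * ((F.L : ℝ)⁻¹) ^ (2 * (K - J)) *
                  (⨅ w : {w : Site (F.P K) 0 → Matrix.specialUnitaryGroup (Fin 2) ℂ |
                      ∀ U : GaugeField (F.P K) 0 (Matrix.specialUnitaryGroup (Fin 2) ℂ),
                        descendTo F ℰp J K hJK (GaugeField.gaugeAct w U) = descendTo F ℰp J K hJK U},
                    ∑ ℓ : PBond (F.P K) 0,
                      dist1 (U ℓ * ((GaugeField.gaugeAct (w : Site (F.P K) 0 → Matrix.specialUnitaryGroup (Fin 2) ℂ) U₀) ℓ)⁻¹) ^ 2)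
                ≤ wilsonAction4 U - minActionRegPr F J K hJK ε₀ V) :
    ∀ (L : ℕ), ∃ pS : ℝ, ∀ (b₀ p₀ : ℝ), 0 < b₀ → pS ≤ p₀ → 0 < p₀ → ∃ ε₁ : ℝ, 0 < ε₁ ∧ ∀ (ε₀ : ℝ), 0 < ε₀ → ε₀ ≤ ε₁ →
      ∃ γ₁ : ℝ, 0 < γ₁ ∧ ∀ (F : T3Family) (γ : ℝ), F.L = L → 0 < γ → γ ≤ γ₁ →
        ∀ (J K : ℕ) (hJK : J ≤ K) (V : GaugeField (F.P J) 0 (Matrix.specialUnitaryGroup (Fin 2) ℂ)), PlaqSmall (θBal F.L γ b₀ p₀ J) V →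
          ∀ U₀ ∈ {U' | U' ∈ fibre F ℰp J K hJK V ∧ U' ∈ histGood F ℰp (θBal F.L γ b₀ p₀) K J ∧
              wilsonAction4 U' = minActionRegPr F J K hJK ε₀ V},
            {U' | U' ∈ fibre F ℰp J K hJK V ∧ U' ∈ histGood F ℰp (θBal F.L γ b₀ p₀) K J ∧
                wilsonAction4 U' = minActionRegPr F J K hJK ε₀ V} =
              {U | ∃ w : Site (F.P K) 0 → Matrix.specialUnitaryGroup (Fin 2) ℂ,
                (∀ U' : GaugeField (F.P K) 0 (Matrix.specialUnitaryGroup (Fin 2) ℂ),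
                    descendTo F ℰp J K hJK (GaugeField.gaugeAct w U') = descendTo F ℰp J K hJK U') ∧
                  U = GaugeField.gaugeAct w U₀} := by
  intro L
  obtain ⟨pS, hpS⟩ := hGap L
  refine ⟨pS, fun b₀ p₀ hb₀ hpS' hp₀ => ?_⟩
  obtain ⟨ε₁, hε₁, hε⟩ := hpS b₀ p₀ hb₀ hpS' hp₀
  refine ⟨ε₁, hε₁, fun ε₀ hε₀ hε₀' => ?_⟩
  obtain ⟨γ₁, hγ₁, μ, hμ, hmain⟩ := hε ε₀ hε₀ hε₀'
  refine ⟨γ₁, hγ₁, fun F γ hFL hγ hγ' J K hJK V hV U₀ hU₀ => ?_⟩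
  have hLpos : (0 : ℝ) < (F.L : ℝ) := Nat.cast_pos.mpr (lt_trans zero_lt_one F.hL.2)
  have hc : 0 < μ * ((F.L : ℝ)⁻¹) ^ (2 * (K - J)) := mul_pos hμ (pow_pos (inv_pos.mpr hLpos) _)
  refine Set.Subset.antisymm (fun U hU => ?_) (fun U hU => ?_)
  · have hUfib : U ∈ fibre F ℰp J K hJK V := hU.1
    have hUgood : U ∈ histGood F ℰp (θBal F.L γ b₀ p₀) K J := hU.2.1
    have hUmin : wilsonAction4 U = minActionRegPr F J K hJK ε₀ V := hU.2.2
    have h := hmain F γ hFL hγ hγ' J K hJK V hV U₀ hU₀ U hUfib hUgood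
    have h0 : wilsonAction4 U - minActionRegPr F J K hJK ε₀ V = 0 := by rw [hUmin, sub_self]
    have hI : (⨅ w : {w : Site (F.P K) 0 → Matrix.specialUnitaryGroup (Fin 2) ℂ |
          ∀ U : GaugeField (F.P K) 0 (Matrix.specialUnitaryGroup (Fin 2) ℂ),
            descendTo F ℰp J K hJK (GaugeField.gaugeAct w U) = descendTo F ℰp J K hJK U},
        ∑ ℓ : PBond (F.P K) 0,
          dist1 (U ℓ * ((GaugeField.gaugeAct (w : Site (F.P K) 0 → Matrix.specialUnitaryGroup (Fin 2) ℂ) U₀) ℓ)⁻¹) ^ 2) ≤ 0 := by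
      by_contra hI
      have hpos := mul_pos hc (not_le.mp hI)
      exact absurd (h.trans_eq h0) (not_le.mpr hpos)
    have hex := exists_eq_gaugeAct_of_iInf_le_zero F hJK U U₀ hI
    exact hex
  · obtain ⟨w, hw, hUw⟩ := hU
    rw [hUw]
    exact (gaugeAct_mem_argmin_iff_of_residual F hJK hw U₀ V).mpr hU₀

/-- ★ **EXW ∧ GAP♯ ⇒ GAP**: hypotheses = the v6 texts of `WindowExactness` (VERBATIM) and of `UniformFibreGapOrbit` (the two
substitutions as above); conclusion = the v6 text of `UniformFibreGap` (with `argminHist` written out).  EXW's clause 2 puts a point `U₀`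
in the argmin set; every residual translate `w•U₀` is again in it, so the infimum over the argmin set is below the infimum over the
orbit; thresholds merge by `max`/`min`. [cite: Balaban1985Variational, Thm 1 (8)-(10) p.279 and (142) p.299] -/
theorem uniformFibreGap_of_exactness_of_gapOrbit
    (hExw : ∀ (L : ℕ), ∃ pS : ℝ, ∀ (b₀ p₀ : ℝ), 0 < b₀ → pS ≤ p₀ → 0 < p₀ → ∃ ε₁ : ℝ, 0 < ε₁ ∧ ∀ (ε₀ : ℝ), 0 < ε₀ → ε₀ ≤ ε₁ →
      ∃ γ₁ : ℝ, 0 < γ₁ ∧ ∀ (F : T3Family) (γ : ℝ), F.L = L → 0 < γ → γ ≤ γ₁ →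
        ∀ (J K : ℕ) (hJK : J ≤ K) (V : GaugeField (F.P J) 0 (Matrix.specialUnitaryGroup (Fin 2) ℂ)), PlaqSmall (θBal F.L γ b₀ p₀ J) V →
          (∀ U ∈ fibre F ℰp J K hJK V, U ∈ histGood F ℰp (θBal F.L γ b₀ p₀) K J →
              minActionRegPr F J K hJK ε₀ V ≤ wilsonAction4 U) ∧
          (∃ U₀ ∈ regFibrePr F J K hJK ε₀ V, U₀ ∈ histGood F ℰp (θBal F.L γ b₀ p₀) K J ∧
              wilsonAction4 U₀ = minActionRegPr F J K hJK ε₀ V))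
    (hGap : ∀ (L : ℕ), ∃ pS : ℝ, ∀ (b₀ p₀ : ℝ), 0 < b₀ → pS ≤ p₀ → 0 < p₀ → ∃ ε₁ : ℝ, 0 < ε₁ ∧ ∀ (ε₀ : ℝ), 0 < ε₀ → ε₀ ≤ ε₁ →
      ∃ γ₁ : ℝ, 0 < γ₁ ∧ ∃ μ : ℝ, 0 < μ ∧ ∀ (F : T3Family) (γ : ℝ), F.L = L → 0 < γ → γ ≤ γ₁ →
        ∀ (J K : ℕ) (hJK : J ≤ K) (V : GaugeField (F.P J) 0 (Matrix.specialUnitaryGroup (Fin 2) ℂ)), PlaqSmall (θBal F.L γ b₀ p₀ J) V →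
          ∀ U₀ ∈ {U' | U' ∈ fibre F ℰp J K hJK V ∧ U' ∈ histGood F ℰp (θBal F.L γ b₀ p₀) K J ∧
              wilsonAction4 U' = minActionRegPr F J K hJK ε₀ V},
            ∀ U ∈ fibre F ℰp J K hJK V, U ∈ histGood F ℰp (θBal F.L γ b₀ p₀) K J →
              μ * ((F.L : ℝ)⁻¹) ^ (2 * (K - J)) *
                  (⨅ w : {w : Site (F.P K) 0 → Matrix.specialUnitaryGroup (Fin 2) ℂ |
                      ∀ U : GaugeField (F.P K) 0 (Matrix.specialUnitaryGroup (Fin 2) ℂ),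
                        descendTo F ℰp J K hJK (GaugeField.gaugeAct w U) = descendTo F ℰp J K hJK U},
                    ∑ ℓ : PBond (F.P K) 0,
                      dist1 (U ℓ * ((GaugeField.gaugeAct (w : Site (F.P K) 0 → Matrix.specialUnitaryGroup (Fin 2) ℂ) U₀) ℓ)⁻¹) ^ 2)
                ≤ wilsonAction4 U - minActionRegPr F J K hJK ε₀ V) :
    ∀ (L : ℕ), ∃ pS : ℝ, ∀ (b₀ p₀ : ℝ), 0 < b₀ → pS ≤ p₀ → 0 < p₀ → ∃ ε₁ : ℝ, 0 < ε₁ ∧ ∀ (ε₀ : ℝ), 0 < ε₀ → ε₀ ≤ ε₁ →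
      ∃ γ₁ : ℝ, 0 < γ₁ ∧ ∃ μ : ℝ, 0 < μ ∧ ∀ (F : T3Family) (γ : ℝ), F.L = L → 0 < γ → γ ≤ γ₁ →
        ∀ (J K : ℕ) (hJK : J ≤ K) (V : GaugeField (F.P J) 0 (Matrix.specialUnitaryGroup (Fin 2) ℂ)), PlaqSmall (θBal F.L γ b₀ p₀ J) V →
          ∀ U ∈ fibre F ℰp J K hJK V, U ∈ histGood F ℰp (θBal F.L γ b₀ p₀) K J →
            μ * ((F.L : ℝ)⁻¹) ^ (2 * (K - J)) *
                (⨅ U' : ↥{U' | U' ∈ fibre F ℰp J K hJK V ∧ U' ∈ histGood F ℰp (θBal F.L γ b₀ p₀) K J ∧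
                    wilsonAction4 U' = minActionRegPr F J K hJK ε₀ V},
                  ∑ ℓ : PBond (F.P K) 0, dist1 (U ℓ * ((U' : GaugeField (F.P K) 0 (Matrix.specialUnitaryGroup (Fin 2) ℂ)) ℓ)⁻¹) ^ 2)
              ≤ wilsonAction4 U - minActionRegPr F J K hJK ε₀ V := by
  intro L
  obtain ⟨pS₁, h₁⟩ := hExw L
  obtain ⟨pS₂, h₂⟩ := hGap L
  refine ⟨max pS₁ pS₂, fun b₀ p₀ hb₀ hpS hp₀ => ?_⟩
  obtain ⟨ε₁, hε₁, h₁'⟩ := h₁ b₀ p₀ hb₀ ((le_max_left _ _).trans hpS) hp₀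
  obtain ⟨ε₂, hε₂, h₂'⟩ := h₂ b₀ p₀ hb₀ ((le_max_right _ _).trans hpS) hp₀
  refine ⟨min ε₁ ε₂, lt_min hε₁ hε₂, fun ε₀ hε₀ hε₀' => ?_⟩
  obtain ⟨γ₁, hγ₁, h₁''⟩ := h₁' ε₀ hε₀ (hε₀'.trans (min_le_left _ _))
  obtain ⟨γ₂, hγ₂, μ, hμ, h₂''⟩ := h₂' ε₀ hε₀ (hε₀'.trans (min_le_right _ _))
  refine ⟨min γ₁ γ₂, lt_min hγ₁ hγ₂, μ, hμ, fun F γ hFL hγ hγ' J K hJK V hV U hU hUg => ?_⟩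
  obtain ⟨-, U₀, hU₀reg, hU₀good, hU₀min⟩ := h₁'' F γ hFL hγ (hγ'.trans (min_le_left _ _)) J K hJK V hV
  have hU₀arg : U₀ ∈ {U' | U' ∈ fibre F ℰp J K hJK V ∧ U' ∈ histGood F ℰp (θBal F.L γ b₀ p₀) K J ∧
      wilsonAction4 U' = minActionRegPr F J K hJK ε₀ V} :=
    ⟨((mem_regFibrePr_iff F).mp hU₀reg).1, hU₀good, hU₀min⟩
  have hmain := h₂'' F γ hFL hγ (hγ'.trans (min_le_right _ _)) J K hJK V hV U₀ hU₀arg U hU hUg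
  refine le_trans ?_ hmain
  have hLpos : (0 : ℝ) < (F.L : ℝ) := Nat.cast_pos.mpr (lt_trans zero_lt_one F.hL.2)
  have hc : 0 ≤ μ * ((F.L : ℝ)⁻¹) ^ (2 * (K - J)) := (mul_pos hμ (pow_pos (inv_pos.mpr hLpos) _)).le
  refine mul_le_mul_of_nonneg_left ?_ hc
  haveI : Nonempty {w : Site (F.P K) 0 → Matrix.specialUnitaryGroup (Fin 2) ℂ |
      ∀ U : GaugeField (F.P K) 0 (Matrix.specialUnitaryGroup (Fin 2) ℂ),
        descendTo F ℰp J K hJK (GaugeField.gaugeAct w U) = descendTo F ℰp J K hJK U} := ⟨⟨1, residual_one F hJK⟩⟩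
  refine le_ciInf fun w => ?_
  have hmem : GaugeField.gaugeAct (w : Site (F.P K) 0 → Matrix.specialUnitaryGroup (Fin 2) ℂ) U₀ ∈
      {U' | U' ∈ fibre F ℰp J K hJK V ∧ U' ∈ histGood F ℰp (θBal F.L γ b₀ p₀) K J ∧
        wilsonAction4 U' = minActionRegPr F J K hJK ε₀ V} :=
    (gaugeAct_mem_argmin_iff_of_residual F hJK w.2 U₀ V).mpr hU₀arg
  have hbdd : BddBelow (Set.range fun U' : ↥{U' | U' ∈ fibre F ℰp J K hJK V ∧ U' ∈ histGood F ℰp (θBal F.L γ b₀ p₀) K J ∧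
      wilsonAction4 U' = minActionRegPr F J K hJK ε₀ V} =>
        ∑ ℓ : PBond (F.P K) 0, dist1 (U ℓ * ((U' : GaugeField (F.P K) 0 (Matrix.specialUnitaryGroup (Fin 2) ℂ)) ℓ)⁻¹) ^ 2) :=
    ⟨0, by rintro _ ⟨U', rfl⟩; exact Finset.sum_nonneg fun ℓ _ => sq_nonneg _⟩
  have h1 := ciInf_le hbdd ⟨GaugeField.gaugeAct (w : Site (F.P K) 0 → Matrix.specialUnitaryGroup (Fin 2) ℂ) U₀, hmem⟩
  exact h1

end Wrappers

end Summit.QuantumFields.YangMills.Theorems.FluctuationComparisonRegPrIntLS2BetaResidualGaugeOrbit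

end
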